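import Literature.Topology.FourManifolds.IntrinsicFoldCriterion
import Literature.Topology.FourManifolds.IndefiniteFoldModel
import HarnessLib

/-!
# Indefinite fold points: the chart condition is equivalent to the intrinsic one

Topic `Literature/Topology/FourManifolds`.  We package Levine's conditions at a point `p` of a
map `F : ℝ⁴ → ℝ²` — `dF_p ≠ 0`, a covector `ℓ ≠ 0` with `ℓ ∘ dF_p = 0`, and the Hessian of
`ℓ ∘ F` at `p` nondegenerate and indefinite on `ker dF_p` — as the predicate
`IsIntrinsicIndefiniteFold F p`, prove that it is LOCAL and INVARIANT under smooth local
coordinate changes of source and target (the well-definedness of the intrinsic second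
derivative; second-order chain rule), verify it for the model `(t, x, y, z) ↦ (t, x²+y²-z²)` at
the origin, and conclude the characterisation used throughout Baykur–Saeki 2017, §2.1:

  `HasIndefiniteFoldChart F p ↔ IsIntrinsicIndefiniteFold F p`   (for `F` of class `C^∞`),

the direction `←` being `hasIndefiniteFoldChart_of_kerHessian` (`IntrinsicFoldCriterion.lean`).
Everything is PROVED; no named fact.

## References

* R. İ. Baykur, O. Saeki, *Simplifying indefinite fibrations on 4-manifolds*, arXiv:1705.11169
  (Trans. AMS 376, 2023), §2.1. [BaykurSaeki2017]
* Y. Lekili, *Wrinkled fibrations on near-symplectic manifolds*, Geom. Topol. 13 (2009), §3.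
  [Lekili2009]
-/

noncomputable section

-- Instance search through the tower `E →L[ℝ] E →L[ℝ] ℝ` needs one more level of pending depth,
-- as in `MorseLemma.lean` and `HadamardLemma.lean`.
set_option maxSynthPendingDepth 2

open Set Function Filter
open scoped Topology ContDiff

namespace Literature.Topology.FourManifolds

/-- Local notation: `𝔼 n` is the model Euclidean space `EuclideanSpace ℝ (Fin n)`. -/
local notation "𝔼 " n:arg => EuclideanSpace ℝ (Fin n)

/-! ### The predicate -/

/-- **Levine's intrinsic indefinite fold condition** at `p` for `F : ℝ⁴ → ℝ²`: `dF_p ≠ 0`, and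
for some covector `ℓ ≠ 0` with `ℓ ∘ dF_p = 0` (so that `dF_p` has rank one and `p` is a
critical point of `ℓ ∘ F`) the Hessian of `ℓ ∘ F` at `p` is nondegenerate and indefinite on
`ker dF_p` (Baykur–Saeki 2017, §2.1; Lekili 2009, §3). [cite: BaykurSaeki2017, §2.1] -/
def IsIntrinsicIndefiniteFold (F : 𝔼 4 → 𝔼 2) (p : 𝔼 4) : Prop :=
  fderiv ℝ F p ≠ 0 ∧ ∃ ℓ : 𝔼 2 →L[ℝ] ℝ, ℓ ≠ 0 ∧ ℓ.comp (fderiv ℝ F p) = 0 ∧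
    (∀ v : 𝔼 4, fderiv ℝ F p v = 0 →
      (∀ w : 𝔼 4, fderiv ℝ F p w = 0 → fderiv ℝ (fderiv ℝ (fun q => ℓ (F q))) p v w = 0) →
        v = 0) ∧
    (∃ v : 𝔼 4, fderiv ℝ F p v = 0 ∧ fderiv ℝ (fderiv ℝ (fun q => ℓ (F q))) p v v < 0) ∧
    (∃ w : 𝔼 4, fderiv ℝ F p w = 0 ∧ 0 < fderiv ℝ (fderiv ℝ (fun q => ℓ (F q))) p w w)

/-- **The intrinsic condition gives a fold chart** (`hasIndefiniteFoldChart_of_kerHessian`,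
repackaged). [cite: BaykurSaeki2017, §2.1] -/
theorem IsIntrinsicIndefiniteFold.hasIndefiniteFoldChart {F : 𝔼 4 → 𝔼 2} {p : 𝔼 4}
    (h : IsIntrinsicIndefiniteFold F p) (hF : ContDiff ℝ ∞ F) : HasIndefiniteFoldChart F p := by
  obtain ⟨hp, ℓ, hℓ, hℓF, hH, hneg, hpos⟩ := h
  exact hasIndefiniteFoldChart_of_kerHessian hF hp hℓ hℓF hH hneg hpos

/-- **Locality**: the intrinsic condition depends only on the germ of `F` at `p`. [folklore] -/
theorem IsIntrinsicIndefiniteFold.congr_of_eventuallyEq {F₁ F₂ : 𝔼 4 → 𝔼 2} {p : 𝔼 4}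
    (h : IsIntrinsicIndefiniteFold F₁ p) (heq : F₁ =ᶠ[𝓝 p] F₂) :
    IsIntrinsicIndefiniteFold F₂ p := by
  obtain ⟨hp, ℓ, hℓ, hℓF, hH, hneg, hpos⟩ := h
  have h1 : fderiv ℝ F₂ p = fderiv ℝ F₁ p := heq.symm.fderiv_eq
  have h2 : fderiv ℝ (fderiv ℝ (fun q => ℓ (F₂ q))) p = fderiv ℝ (fderiv ℝ (fun q => ℓ (F₁ q))) p :=
    ((heq.symm.fun_comp ℓ).fderiv).fderiv_eq
  refine ⟨by rwa [h1], ℓ, hℓ, by rwa [h1], ?_, ?_, ?_⟩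
  · rw [h1, h2]
    exact hH
  · rw [h1, h2]
    exact hneg
  · rw [h1, h2]
    exact hpos

/-! ### The model fold satisfies the intrinsic condition at the origin -/

/-- The Hessian map of `x₁² + x₂² - x₃²`: `x ↦ 2x₁ dx₁ + 2x₂ dx₂ - 2x₃ dx₃`, linear in `x`.
[folklore] -/
def foldQuadraticHessian : 𝔼 4 →L[ℝ] 𝔼 4 →L[ℝ] ℝ :=
  ((2 : ℝ) • (EuclideanSpace.proj (1 : Fin 4) : 𝔼 4 →L[ℝ] ℝ)).smulRight
      (EuclideanSpace.proj (1 : Fin 4) : 𝔼 4 →L[ℝ] ℝ) +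
    ((2 : ℝ) • (EuclideanSpace.proj (2 : Fin 4) : 𝔼 4 →L[ℝ] ℝ)).smulRight
      (EuclideanSpace.proj (2 : Fin 4) : 𝔼 4 →L[ℝ] ℝ) -
    ((2 : ℝ) • (EuclideanSpace.proj (3 : Fin 4) : 𝔼 4 →L[ℝ] ℝ)).smulRight
      (EuclideanSpace.proj (3 : Fin 4) : 𝔼 4 →L[ℝ] ℝ)

/-- `foldQuadraticHessian v w = 2v₁w₁ + 2v₂w₂ - 2v₃w₃`. [folklore] -/
@[simp] theorem foldQuadraticHessian_apply (v w : 𝔼 4) :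
    foldQuadraticHessian v w = 2 * v 1 * w 1 + 2 * v 2 * w 2 - 2 * v 3 * w 3 := by
  simp [foldQuadraticHessian, ContinuousLinearMap.smulRight_apply]

/-- The second coordinate `x₁² + x₂² - x₃²` of the model fold has derivative
`foldQuadraticHessian x` at `x`. [folklore] -/
theorem hasFDerivAt_indefiniteFoldMap_apply_one (x : 𝔼 4) :
    HasFDerivAt (fun q : 𝔼 4 => indefiniteFoldMap q 1) (foldQuadraticHessian x) x := by
  have hc : ∀ i : Fin 4, HasFDerivAt (fun x : 𝔼 4 => x i)
      (EuclideanSpace.proj i : 𝔼 4 →L[ℝ] ℝ) x := fun i =>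
    (EuclideanSpace.proj i : 𝔼 4 →L[ℝ] ℝ).hasFDerivAt
  have hq : HasFDerivAt (fun x : 𝔼 4 => x 1 ^ 2 + x 2 ^ 2 - x 3 ^ 2) (foldQuadraticHessian x)
      x := by
    refine ((((hc 1).pow 2).add ((hc 2).pow 2)).sub ((hc 3).pow 2)).congr_fderiv ?_
    ext v
    simp [foldQuadraticHessian, ContinuousLinearMap.smulRight_apply]
  refine hq.congr_of_eventuallyEq (Eventually.of_forall fun q => ?_)
  exact indefiniteFoldMap_apply_one q

/-- The Hessian of the second coordinate of the model fold is `foldQuadraticHessian`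
everywhere. [folklore] -/
theorem fderiv_fderiv_indefiniteFoldMap_apply_one (x : 𝔼 4) :
    fderiv ℝ (fderiv ℝ (fun q : 𝔼 4 => indefiniteFoldMap q 1)) x = foldQuadraticHessian := by
  have h1 : fderiv ℝ (fun q : 𝔼 4 => indefiniteFoldMap q 1) = fun x => foldQuadraticHessian x :=
    funext fun x => (hasFDerivAt_indefiniteFoldMap_apply_one x).fderiv
  rw [h1]
  exact foldQuadraticHessian.fderiv

/-- The differential of the model fold at the origin has kernel `{v₀ = 0}`. [folklore] -/
theorem fderiv_indefiniteFoldMap_zero_apply_eq_zero_iff (v : 𝔼 4) :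
    fderiv ℝ indefiniteFoldMap 0 v = 0 ↔ v 0 = 0 := by
  rw [fderiv_indefiniteFoldMap]
  constructor
  · intro h
    have := congrArg (fun u : 𝔼 2 => u 0) h
    simpa using this
  · intro h
    ext i
    fin_cases i
    · simpa using h
    · simp

/-- **The model fold `(t, x² + y² - z²)` satisfies the intrinsic condition at `0`**, with
`ℓ = dy₁`: the kernel of `dF_0` is `{v₀ = 0}` and the Hessian of `F₁` there is
`2(dx₁² + dx₂² - dx₃²)`, nondegenerate of signature `(2, 1)`. [folklore] -/
theorem isIntrinsicIndefiniteFold_indefiniteFoldMap_zero :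
    IsIntrinsicIndefiniteFold indefiniteFoldMap 0 := by
  set ℓ : 𝔼 2 →L[ℝ] ℝ := EuclideanSpace.proj (1 : Fin 2) with hℓ_def
  have hℓapp : ∀ u : 𝔼 2, ℓ u = u 1 := fun u => rfl
  have hHess : ∀ v w : 𝔼 4, fderiv ℝ (fderiv ℝ (fun q => ℓ (indefiniteFoldMap q))) 0 v w =
      2 * v 1 * w 1 + 2 * v 2 * w 2 - 2 * v 3 * w 3 := fun v w => by
    simp only [hℓapp]
    rw [fderiv_fderiv_indefiniteFoldMap_apply_one, foldQuadraticHessian_apply]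
  refine ⟨?_, ℓ, ?_, ?_, ?_, ?_, ?_⟩
  · intro h
    have := congrArg (fun T : 𝔼 4 →L[ℝ] 𝔼 2 => T (EuclideanSpace.single (0 : Fin 4) (1 : ℝ)) 0) h
    rw [fderiv_indefiniteFoldMap] at this
    simp at this
  · intro h
    have := congrArg (fun T : 𝔼 2 →L[ℝ] ℝ => T (EuclideanSpace.single (1 : Fin 2) (1 : ℝ))) h
    simp [hℓapp] at this
  · ext v
    rw [ContinuousLinearMap.comp_apply, hℓapp, fderiv_indefiniteFoldMap,
      indefiniteFoldDeriv_apply_one]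
    simp
  · intro v hv hvw
    rw [fderiv_indefiniteFoldMap_zero_apply_eq_zero_iff] at hv
    have h1 := hvw (EuclideanSpace.single (1 : Fin 4) (1 : ℝ))
      ((fderiv_indefiniteFoldMap_zero_apply_eq_zero_iff _).2 (by simp))
    have h2 := hvw (EuclideanSpace.single (2 : Fin 4) (1 : ℝ))
      ((fderiv_indefiniteFoldMap_zero_apply_eq_zero_iff _).2 (by simp))
    have h3 := hvw (EuclideanSpace.single (3 : Fin 4) (1 : ℝ))
      ((fderiv_indefiniteFoldMap_zero_apply_eq_zero_iff _).2 (by simp))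
    rw [hHess] at h1 h2 h3
    simp at h1 h2 h3
    ext i
    fin_cases i
    · simpa using hv
    · simpa using h1
    · simpa using h2
    · simpa using h3
  · refine ⟨EuclideanSpace.single (3 : Fin 4) (1 : ℝ),
      (fderiv_indefiniteFoldMap_zero_apply_eq_zero_iff _).2 (by simp), ?_⟩
    rw [hHess]
    simp
  · refine ⟨EuclideanSpace.single (1 : Fin 4) (1 : ℝ),
      (fderiv_indefiniteFoldMap_zero_apply_eq_zero_iff _).2 (by simp), ?_⟩
    rw [hHess]
    simp

/-! ### Invariance under smooth local coordinate changes -/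

/-- **The intrinsic condition is invariant under local diffeomorphisms** (well-definedness of
the intrinsic second derivative).  If `Φ₀` is a local diffeomorphism of `ℝ⁴` at `p`, `Ψ₀` one of
`ℝ²` with `F (Φ₀.source) ⊆ Ψ₀.source`, and a map `G` of class `C²` at `Φ₀ p` agreeing with the
local representative `Ψ₀ ∘ F ∘ Φ₀⁻¹` near `Φ₀ p` satisfies the intrinsic indefinite fold condition
at `Φ₀ p`, then `F` satisfies it at `p`: with `A = dΦ₀(p)`, `B = dΨ₀(F p)` one has
`dF_p = B⁻¹ ∘ dG ∘ A`, the covector `ℓ ∘ B` annihilates `im dF_p`, and on `ker dF_p = A⁻¹(ker dG)`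
the Hessian of `(ℓ ∘ B) ∘ F` is the pull-back by `A` of the Hessian of `ℓ ∘ G` (second-order
chain rule; the first-order terms die on the kernel). [folklore] -/
theorem IsIntrinsicIndefiniteFold.of_localRepresentative {F : 𝔼 4 → 𝔼 2} {p : 𝔼 4}
    {Φ₀ : OpenPartialHomeomorph (𝔼 4) (𝔼 4)} {Ψ₀ : OpenPartialHomeomorph (𝔼 2) (𝔼 2)}
    (hΦ₀ : ContDiffOn ℝ ∞ Φ₀ Φ₀.source) (hΦ₀s : ContDiffOn ℝ ∞ Φ₀.symm Φ₀.target)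
    (hΨ₀ : ContDiffOn ℝ ∞ Ψ₀ Ψ₀.source) (hΨ₀s : ContDiffOn ℝ ∞ Ψ₀.symm Ψ₀.target)
    (hmaps : MapsTo F Φ₀.source Ψ₀.source) (hp : p ∈ Φ₀.source) {G : 𝔼 4 → 𝔼 2}
    (hG : ContDiffAt ℝ 2 G (Φ₀ p)) (hGF : G =ᶠ[𝓝 (Φ₀ p)] (Ψ₀ ∘ F ∘ Φ₀.symm))
    (h : IsIntrinsicIndefiniteFold G (Φ₀ p)) : IsIntrinsicIndefiniteFold F p := by
  have h2 : (2 : WithTop ℕ∞) ≤ ∞ := WithTop.coe_le_coe.2 le_top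
  obtain ⟨hdG, ℓ, hℓ, hℓG, hH, hneg, hpos⟩ := h
  have hFp : F p ∈ Ψ₀.source := hmaps hp
  obtain ⟨A, hAd, hAsd⟩ := exists_fderiv_continuousLinearEquiv Φ₀ hΦ₀ hΦ₀s (by simp) hp
  obtain ⟨B, hBd, hBsd⟩ := exists_fderiv_continuousLinearEquiv Ψ₀ hΨ₀ hΨ₀s (by simp) hFp
  -- `G (Φ₀ p) = Ψ₀ (F p)` and `F = Ψ₀⁻¹ ∘ G ∘ Φ₀` near `p`
  have hG0 : G (Φ₀ p) = Ψ₀ (F p) := by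
    have := hGF.eq_of_nhds
    simpa [Φ₀.left_inv hp] using this
  have hΦc : ContinuousAt Φ₀ p := (hΦ₀.continuousOn.continuousAt (Φ₀.open_source.mem_nhds hp))
  have hev : F =ᶠ[𝓝 p] fun q => Ψ₀.symm (G (Φ₀ q)) := by
    have h1 : ∀ᶠ q in 𝓝 p, G (Φ₀ q) = (Ψ₀ ∘ F ∘ Φ₀.symm) (Φ₀ q) := hΦc.eventually hGF
    filter_upwards [h1, Φ₀.open_source.mem_nhds hp] with q hq hqs
    rw [hq]
    simp [Φ₀.left_inv hqs, Ψ₀.left_inv (hmaps hqs)]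
  -- derivatives
  have hGd : HasFDerivAt G (fderiv ℝ G (Φ₀ p)) (Φ₀ p) := (hG.differentiableAt (by simp)).hasFDerivAt
  have hBsd' : HasFDerivAt Ψ₀.symm (B.symm : 𝔼 2 →L[ℝ] 𝔼 2) (G (Φ₀ p)) := by
    rw [hG0]
    exact hBsd
  have hFd : HasFDerivAt F
      ((B.symm : 𝔼 2 →L[ℝ] 𝔼 2).comp ((fderiv ℝ G (Φ₀ p)).comp (A : 𝔼 4 →L[ℝ] 𝔼 4))) p :=
    (hBsd'.comp p (hGd.comp p hAd)).congr_of_eventuallyEq hev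
  have hDF : fderiv ℝ F p =
      (B.symm : 𝔼 2 →L[ℝ] 𝔼 2).comp ((fderiv ℝ G (Φ₀ p)).comp (A : 𝔼 4 →L[ℝ] 𝔼 4)) :=
    hFd.fderiv
  have hDF' : ∀ v : 𝔼 4, fderiv ℝ F p v = B.symm (fderiv ℝ G (Φ₀ p) (A v)) := fun v => by
    rw [hDF]
    rfl
  -- kernels correspond under `A`
  have hker : ∀ v : 𝔼 4, fderiv ℝ F p v = 0 ↔ fderiv ℝ G (Φ₀ p) (A v) = 0 := fun v => by
    rw [hDF']
    constructor
    · intro h0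
      exact B.symm.injective (by rw [h0, map_zero])
    · intro h0
      rw [h0, map_zero]
  -- the new covector `ℓ ∘ B`
  set ℓF : 𝔼 2 →L[ℝ] ℝ := ℓ.comp (B : 𝔼 2 →L[ℝ] 𝔼 2) with hℓF_def
  have hℓFapp : ∀ u : 𝔼 2, ℓF u = ℓ (B u) := fun u => rfl
  -- the scalar function `ℓF ∘ F = m ∘ G ∘ Φ₀` near `p`, `m = ℓ ∘ B ∘ Ψ₀⁻¹`, `dm = ℓ`
  set m : 𝔼 2 → ℝ := fun z => ℓF (Ψ₀.symm z) with hm_def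
  have hmd : HasFDerivAt m ℓ (G (Φ₀ p)) := by
    have h1 := ℓF.hasFDerivAt.comp (G (Φ₀ p)) hBsd'
    refine h1.congr_fderiv ?_
    ext u
    simp [hℓFapp]
  have hmc : ContDiffAt ℝ 2 m (G (Φ₀ p)) := by
    have hψc : ContDiffAt ℝ ∞ Ψ₀.symm (G (Φ₀ p)) := by
      rw [hG0]
      exact hΨ₀s.contDiffAt (Ψ₀.open_target.mem_nhds (Ψ₀.map_source hFp))
    exact (ℓF.contDiff.contDiffAt.comp (G (Φ₀ p)) hψc).of_le h2
  have hmGc : ContDiffAt ℝ 2 (m ∘ G) (Φ₀ p) := hmc.comp (Φ₀ p) hG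
  have hmGcrit : fderiv ℝ (m ∘ G) (Φ₀ p) = 0 := by
    rw [(hmd.comp (Φ₀ p) hGd).fderiv]
    exact hℓG
  have hΦc2 : ContDiffAt ℝ 2 Φ₀ p := (hΦ₀.contDiffAt (Φ₀.open_source.mem_nhds hp)).of_le h2
  have hevh : (fun q => ℓF (F q)) =ᶠ[𝓝 p] ((m ∘ G) ∘ Φ₀) := by
    filter_upwards [hev] with q hq
    show ℓF (F q) = ℓF (Ψ₀.symm (G (Φ₀ q)))
    rw [← hq]
  -- KEY: on `ker dF_p` the Hessian of `ℓF ∘ F` is the pull-back of that of `ℓ ∘ G`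
  have hkey : ∀ v w : 𝔼 4, fderiv ℝ F p v = 0 →
      fderiv ℝ (fderiv ℝ (fun q => ℓF (F q))) p v w =
        fderiv ℝ (fderiv ℝ (fun y => ℓ (G y))) (Φ₀ p) (A v) (A w) := by
    intro v w hv
    have hAv : fderiv ℝ G (Φ₀ p) ((A : 𝔼 4 →L[ℝ] 𝔼 4) v) = 0 := (hker v).1 hv
    rw [hevh.fderiv.fderiv_eq, fderiv_fderiv_comp_apply_of_fderiv_eq_zero' hmGc hΦc2 hmGcrit,
      hAd.fderiv, fderiv_fderiv_comp_apply_eq_add hmc hG, hmd.fderiv, hAv, map_zero,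
      zero_apply, add_zero]
    rw [show (fun y => ℓ (G y)) = (ℓ : 𝔼 2 → ℝ) ∘ G from rfl,
      fderiv_fderiv_continuousLinearMap_comp_apply ℓ hG]
    rfl
  refine ⟨?_, ℓF, ?_, ?_, ?_, ?_, ?_⟩
  · -- `dF_p ≠ 0`
    intro h0
    apply hdG
    ext1 y
    have h1 : fderiv ℝ G (Φ₀ p) (A (A.symm y)) = B (fderiv ℝ F p (A.symm y)) := by
      rw [hDF', B.apply_symm_apply]
    rw [A.apply_symm_apply] at h1
    rw [zero_apply, h1, h0, zero_apply, map_zero]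
  · -- `ℓF ≠ 0`
    intro h0
    apply hℓ
    ext u
    have := congrArg (fun T : 𝔼 2 →L[ℝ] ℝ => T (B.symm u)) h0
    simpa [hℓFapp] using this
  · -- `ℓF ∘ dF_p = 0`
    ext v
    rw [ContinuousLinearMap.comp_apply, hDF', hℓFapp, B.apply_symm_apply]
    simpa using congrArg (fun T : 𝔼 4 →L[ℝ] ℝ => T (A v)) hℓG
  · -- nondegeneracy on the kernel
    intro v hv hvw
    have hAv : fderiv ℝ G (Φ₀ p) (A v) = 0 := (hker v).1 hv
    have hz : A v = 0 := by
      refine hH (A v) hAv fun k hk => ?_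
      have hk' : fderiv ℝ F p (A.symm k) = 0 := (hker _).2 (by simpa using hk)
      have := hvw (A.symm k) hk'
      rwa [hkey v (A.symm k) hv, A.apply_symm_apply] at this
    simpa using congrArg A.symm hz
  · -- a negative kernel vector
    obtain ⟨a, ha, haneg⟩ := hneg
    refine ⟨A.symm a, (hker _).2 (by simpa using ha), ?_⟩
    rw [hkey _ _ ((hker _).2 (by simpa using ha)), A.apply_symm_apply]
    exact haneg
  · -- a positive kernel vector
    obtain ⟨b, hb, hbpos⟩ := hpos
    refine ⟨A.symm b, (hker _).2 (by simpa using hb), ?_⟩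
    rw [hkey _ _ ((hker _).2 (by simpa using hb)), A.apply_symm_apply]
    exact hbpos

/-! ### The characterisation -/

/-- **A fold chart forces the intrinsic condition**: in the chart `F` is the model fold, which
satisfies the condition at `0`, and the condition is invariant. [cite: BaykurSaeki2017, §2.1] -/
theorem HasIndefiniteFoldChart.isIntrinsicIndefiniteFold {F : 𝔼 4 → 𝔼 2} {p : 𝔼 4}
    (h : HasIndefiniteFoldChart F p) : IsIntrinsicIndefiniteFold F p := by
  obtain ⟨φ, ψ, hpφ, hp0, hmaps, hφ, hφs, hψ, hψs, hid⟩ := h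
  have h0t : (0 : 𝔼 4) ∈ φ.target := hp0 ▸ φ.map_source hpφ
  have hGF : indefiniteFoldMap =ᶠ[𝓝 (φ p)] (ψ ∘ F ∘ φ.symm) := by
    rw [hp0]
    filter_upwards [φ.open_target.mem_nhds h0t] with y hy
    obtain ⟨h0', h1'⟩ := hid (φ.symm y) (φ.map_target hy)
    rw [φ.right_inv hy] at h0' h1'
    exact (eq_indefiniteFoldMap_of_apply h0' h1').symm
  have hmodel : IsIntrinsicIndefiniteFold indefiniteFoldMap (φ p) := by
    rw [hp0]
    exact isIntrinsicIndefiniteFold_indefiniteFoldMap_zero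
  exact IsIntrinsicIndefiniteFold.of_localRepresentative hφ hφs hψ hψs hmaps hpφ
    (contDiff_indefiniteFoldMap.contDiffAt.of_le (WithTop.coe_le_coe.2 le_top)) hGF hmodel

/-- **Characterisation of indefinite fold points** of a `C^∞` map `F : ℝ⁴ → ℝ²`: `F` admits
the chart `(t, x² + y² - z²)` at `p` (the clause `IsSimplifiedBrokenLefschetzFibration.fold`)
iff `dF_p` has rank one and the intrinsic second derivative on `ker dF_p` is nondegenerate and
indefinite (Baykur–Saeki 2017, §2.1, "indefinite otherwise"; Lekili 2009, §3).
[cite: BaykurSaeki2017, §2.1] -/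
theorem hasIndefiniteFoldChart_iff_isIntrinsicIndefiniteFold {F : 𝔼 4 → 𝔼 2} (hF : ContDiff ℝ ∞ F)
    {p : 𝔼 4} : HasIndefiniteFoldChart F p ↔ IsIntrinsicIndefiniteFold F p :=
  ⟨fun h => h.isIntrinsicIndefiniteFold, fun h => h.hasIndefiniteFoldChart hF⟩

end Literature.Topology.FourManifolds

end
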